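import Literature.NumberTheory.LFunctions.MatomakiRadziwillTaoKeyEstimate
import Literature.NumberTheory.LFunctions.MatomakiRadziwillTaoMajorArcWith
import HarnessLib

/-!
# Matomäki–Radziwiłł–Tao 2015, Proposition 2.4 and Theorem 2.3 re-run from Theorem A.2 with an abstract middle term

Topic `Literature/NumberTheory/LFunctions`.  Everything in this file is PROVED; no definitions, no named facts.
The hA2-dependent statements of `MatomakiRadziwillTaoProp24.lean` (`prop24_discrete`) and
`MatomakiRadziwillTaoKeyEstimate.lean` (`keyEstimate_typ`), with the named fact
`MatomakiRadziwillTao2015_theoremA2` replaced by the hypothesis schema `MRT2015.TheoremA2With mid`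
(`MatomakiRadziwillTaoTheoremA2With.lean`) through `MRT2015.A2With.majorArc_le`
(`MatomakiRadziwillTaoMajorArcWith.lean`), and the non-pretentiousness hypothesis `3 log W ≤ M(g; X, W)`
replaced by `κ log W ≤ M(g; X, W)` (`κ ≥ 3`, with the decay `√(mid(κ log W - 48)) ≤ C_m W^{-5/4}`):

* `MRT2015.A2With.prop24_discrete` — Proposition 2.4 in discrete form;
* `MRT2015.A2With.keyEstimate_typ` — Theorem 2.3 in discrete form (`W = V⁵`, hypothesis `5κ log V ≤ M(g; X, V⁵)`).

The proofs are those of the tree verbatim.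

## References
* K. Matomäki, M. Radziwiłł, T. Tao, Algebra & Number Theory 9 (2015), §2 (Theorem 2.3, Proposition 2.4), §4,
  Appendix A. [cite: MatomakiRadziwillTao2015, Theorem 2.3]
-/

noncomputable section

open Finset Real ArithmeticFunction
open scoped Classical FourierTransform

namespace Literature.NumberTheory.LFunctions

namespace MRT2015

namespace A2With

open Literature.NumberTheory.Sieve.Lichtman2020 (windowDiv mem_windowDiv sum_card_windowDiv_le)
open Sieve.Vinogradov

/-! ### Proposition 2.4, discrete form -/

set_option maxHeartbeats 400000 in
/-- **[MRT2015, Proposition 2.4] in discrete form, from the schema `TheoremA2With mid`.**  There are absolute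
`C, W₀, X⁎` such that for `g` completely multiplicative and `1`-bounded, heights `X⁎ ≤ X ≤ X₃ ≤ 2X`,
`W₀ ≤ W ≤ log^{1/125} X`, a scale `1 ≤ d < W`, a window `L` with `W^{203} ≤ L`, `L W^{15} ≤ X`,
`L ≤ exp(√(log X / 2))`, `log⁵ L ≤ W`, and `M(g; X, W) ≥ κ log W` (hypothesis (2-4) with `3 ↦ κ`), for every real
`α`,
`∑_{x ≤ X₃} |∑_{x < dm ≤ x + L, m ∈ 𝒮'} g(m) e(αm)| ≤ C L X₃ (W⁻² + d⁻¹ W^{-1/4} + (1 + log L)/√(dW))`,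
`𝒮' = 𝒮_{W^{200}, L/W³, √X₃, X₃/d}`.  Proof as printed: Dirichlet's approximation theorem gives
`a/q`, `(a,q) = 1`, `1 ≤ q ≤ L/W`, `|α - a/q| ≤ W/(qL) ≤ q⁻²`; the case `q ≤ W` is `majorArc_le`,
the case `q > W` is `minorArc_typ_le` with `minorArc_numerics` (proof of `MRT2015.prop24_discrete` verbatim).
[cite: MatomakiRadziwillTao2015, Proposition 2.4] -/
theorem prop24_discrete {mid : ℝ → ℝ} (hmid0 : ∀ M : ℝ, 0 ≤ M → 0 ≤ mid M)
    (hanti : ∀ a b : ℝ, 1 ≤ a → a ≤ b → mid b ≤ mid a) (hA2 : TheoremA2With mid)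
    {κ Cm W₁ : ℝ} (hκ : 3 ≤ κ) (hCm : 0 ≤ Cm)
    (hdecay : ∀ W : ℝ, W₁ ≤ W → Real.sqrt (mid (κ * Real.log W - 48)) ≤ Cm * W ^ (-(5 : ℝ) / 4)) :
    ∃ C W₀ Xs : ℝ, 0 < C ∧ ∀ (X X₃ W : ℝ) (L d : ℕ) (α : ℝ) (g : ArithmeticFunction ℂ),
      (∀ m n : ℕ, g (m * n) = g m * g n) → g 1 = 1 → (∀ n, ‖g n‖ ≤ 1) →
      Xs ≤ X → X ≤ X₃ → X₃ ≤ 2 * X → W₀ ≤ W → W ≤ Real.log X ^ (1 / 125 : ℝ) →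
      1 ≤ d → (d : ℝ) < W →
      W ^ 203 ≤ (L : ℝ) → (L : ℝ) * W ^ 15 ≤ X → (L : ℝ) ≤ Real.exp (Real.sqrt (Real.log X / 2)) →
      Real.log L ^ 5 ≤ W → κ * Real.log W ≤ Sieve.nonpretentiousness g X W →
      ∑ x ∈ range (⌊X₃⌋₊ + 1), ‖∑ m ∈ Ioc (x / d) ((x + L) / d),
          typFun g (W ^ 200) (L / W ^ 3) (Real.sqrt X₃) (X₃ / d) m * (𝐞 (α * m) : ℂ)‖ ≤
        C * L * X₃ * (1 / W ^ 2 + 1 / (d * W ^ (1 / 4 : ℝ)) +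
          (1 + Real.log L) / Real.sqrt (d * W)) := by
  obtain ⟨C₁, W₁', X₁, hC₁, hmaj⟩ := A2With.majorArc_le hmid0 hanti hA2 hκ hCm hdecay
  refine ⟨C₁ + 212, max W₁' 3, max X₁ 1, by positivity, ?_⟩
  intro X X₃ W L d α g hg hg1' hg1 hXs hXX₃ hX₃ hW₀ hWX hd hdW hWL hLX hLexp hlogL hM
  -- basics
  have hW₁ : W₁' ≤ W := (le_max_left _ _).trans hW₀
  have hW3 : 3 ≤ W := (le_max_right _ _).trans hW₀
  have hW0 : 0 < W := by linarith
  have hW1 : 1 ≤ W := by linarith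
  have hX₁ : X₁ ≤ X := (le_max_left _ _).trans hXs
  have hX1 : 1 ≤ X := (le_max_right _ _).trans hXs
  have hX₃1 : 1 ≤ X₃ := hX1.trans hXX₃
  have hd0 : 0 < d := hd
  have hLW : W ≤ (L : ℝ) := le_trans (le_self_pow₀ hW1 (by norm_num)) hWL
  have hL1 : (1 : ℝ) ≤ L := hW1.trans hLW
  have hL0 : (0 : ℝ) < L := by linarith
  have hL : 1 ≤ L := by exact_mod_cast hL1
  have hLX' : (L : ℝ) ≤ X := by
    calc (L : ℝ) = L * 1 := (mul_one _).symm
      _ ≤ L * W ^ 15 := mul_le_mul_of_nonneg_left (one_le_pow₀ hW1) hL0.le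
      _ ≤ X := hLX
  have hLX₃ : (L : ℝ) ≤ X₃ := hLX'.trans hXX₃
  have hlogL0 : 0 ≤ Real.log L := Real.log_nonneg hL1
  have hextra : 0 ≤ (1 + Real.log L) / Real.sqrt (d * W) := by positivity
  have hA0 : 0 ≤ 1 / W ^ 2 + 1 / ((d : ℝ) * W ^ (1 / 4 : ℝ)) := by positivity
  have hLX0 : 0 ≤ (L : ℝ) * X₃ := by positivity
  -- Dirichlet's approximation theorem with `Q = L/W`
  set n : ℕ := ⌊(L : ℝ) / W⌋₊ with hn
  have hLW1 : 1 ≤ (L : ℝ) / W := by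
    rw [le_div_iff₀ hW0, one_mul]; exact hLW
  have hn1 : 1 ≤ n := Nat.le_floor (by exact_mod_cast hLW1)
  have hnle : (n : ℝ) ≤ L / W := Nat.floor_le (by positivity)
  have hnlt : (L : ℝ) / W < n + 1 := Nat.lt_floor_add_one _
  obtain ⟨r, hr, hden⟩ := Real.exists_rat_abs_sub_le_and_den_le α (by omega : 0 < n)
  set q : ℕ := r.den with hq
  have hq1 : 1 ≤ q := r.den_pos
  have hq0 : (0 : ℝ) < q := by exact_mod_cast hq1
  have hqn : (q : ℝ) ≤ n := by exact_mod_cast hden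
  have hqL : (q : ℝ) ≤ L / W := hqn.trans hnle
  have hrq : ((r.num : ℝ) / (q : ℕ) : ℝ) = (r : ℝ) := by rw [hq, Rat.cast_def]
  have hcop : IsCoprime r.num (q : ℤ) := by
    refine Int.isCoprime_iff_gcd_eq_one.mpr ?_
    show Nat.gcd r.num.natAbs r.den = 1
    exact r.reduced
  have hβ : |α - r.num / q| ≤ W / (q * L) := by
    rw [hrq]
    refine hr.trans ?_
    rw [div_le_div_iff₀ (by positivity) (by positivity), one_mul]
    have : (L : ℝ) ≤ W * (n + 1) := by
      rw [div_lt_iff₀ hW0] at hnlt; linarith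
    nlinarith
  have hα2 : |α - r.num / q| ≤ 1 / (q : ℝ) ^ 2 := by
    rw [hrq]
    refine hr.trans ?_
    rw [sq]
    refine one_div_le_one_div_of_le (by positivity) ?_
    refine mul_le_mul_of_nonneg_right ?_ hq0.le
    linarith
  rcases le_or_gt (q : ℝ) W with hqW | hWq
  · -- major arc
    have h := hmaj X X₃ W L d q r.num α g hg hg1' hg1 hX₁ hXX₃ hX₃ hW₁ hWX hd hdW hq1 hqW hβ
      hWL hLX hLexp hlogL hM
    refine h.trans ?_
    have h1 : C₁ * L * X₃ * (1 / W ^ 2 + 1 / (d * W ^ (1 / 4 : ℝ))) ≤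
        C₁ * L * X₃ * (1 / W ^ 2 + 1 / (d * W ^ (1 / 4 : ℝ)) +
          (1 + Real.log L) / Real.sqrt (d * W)) :=
      mul_le_mul_of_nonneg_left (le_add_of_nonneg_right hextra) (by positivity)
    refine h1.trans ?_
    apply mul_le_mul_of_nonneg_right _ (by positivity)
    apply mul_le_mul_of_nonneg_right _ (by positivity)
    exact mul_le_mul_of_nonneg_right (by linarith) (by positivity)
  · -- minor arc
    have hP2 : (2 : ℝ) ≤ W ^ 200 := le_trans (by linarith) (le_self_pow₀ hW1 (by norm_num))
    have hlog3 : 1 ≤ Real.log 3 := by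
      rw [← Real.log_exp 1]
      refine Real.log_le_log (Real.exp_pos 1) ?_
      have := Real.exp_one_lt_d9; linarith
    have hlogW : 1 ≤ Real.log W := hlog3.trans (Real.log_le_log (by norm_num) hW3)
    have hP : 1 ≤ Real.log (W ^ 200) := by
      rw [Real.log_pow]; push_cast; nlinarith
    have hQ0 : 0 < (L : ℝ) / W ^ 3 := by positivity
    have hQW : W ≤ (L : ℝ) / W ^ 3 := by
      rw [le_div_iff₀ (by positivity)]
      calc W * W ^ 3 = W ^ 4 := by ring
        _ ≤ W ^ 203 := pow_le_pow_right₀ hW1 (by norm_num)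
        _ ≤ L := hWL
    have hQ : 1 ≤ Real.log ((L : ℝ) / W ^ 3) :=
      hlogW.trans (Real.log_le_log hW0 hQW)
    have hQX₀ : (L : ℝ) / W ^ 3 ≤ Real.exp (Real.sqrt (Real.log (Real.sqrt X₃))) := by
      have h1 : (L : ℝ) / W ^ 3 ≤ L := div_le_self hL0.le (one_le_pow₀ hW1)
      refine h1.trans (hLexp.trans ?_)
      rw [Real.exp_le_exp, Real.log_sqrt (by linarith)]
      exact Real.sqrt_le_sqrt (by linarith [Real.log_le_log (by linarith) hXX₃])
    have h := minorArc_typ_le (g := ⇑g) hg hg1 hP2 hP hQ0 hQ hQX₀ hd0 hL hq1 hcop hα2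
      (X₃ := X₃)
    have hnum := minorArc_numerics hW3 hd hWq hqL hWL hX₃1 hLX₃
    refine h.trans (hnum.trans ?_)
    have hmid : 0 ≤ 1 / ((d : ℝ) * W ^ (1 / 4 : ℝ)) := by positivity
    have h1 : 212 * (L : ℝ) * X₃ * ((1 + Real.log L) / Real.sqrt (d * W) + 1 / W ^ 2) ≤
        212 * (L : ℝ) * X₃ * (1 / W ^ 2 + 1 / (d * W ^ (1 / 4 : ℝ)) +
          (1 + Real.log L) / Real.sqrt (d * W)) :=
      mul_le_mul_of_nonneg_left (by linarith) (by positivity)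
    refine h1.trans ?_
    apply mul_le_mul_of_nonneg_right _ (by positivity)
    apply mul_le_mul_of_nonneg_right _ (by positivity)
    exact mul_le_mul_of_nonneg_right (by linarith) (by positivity)

/-! ### Theorem 2.3, discrete form -/

set_option maxHeartbeats 1600000 in
/-- **[MRT2015, Theorem 2.3] (key exponential sum estimate) in discrete form, from the schema `TheoremA2With mid`.**
There are absolute `C, V₀, X⁎` such that for `g` multiplicative and `1`-bounded, `V ≥ V₀`,
heights `X⁎ ≤ X ≤ X₃ ≤ 2X`, a window `L` with `log L ≤ V`, `V^{1015} ≤ L`, `L V^{75} ≤ X`,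
`L ≤ exp(√(log X / 2))`, `V⁵ ≤ log^{1/125} X` and `M(g; X, V⁵) ≥ 5κ log V` (hypothesis (2-1) with
`W = V⁵`, `3 ↦ κ`), for every real `α`,
`∑_{x ≤ X₃} |∑_{x < n ≤ x+L, n ∈ 𝒮} g(n) e(αn)| ≤ C L X₃ / V`, `𝒮 = 𝒮_{W^{200}, L/W³, √X₃, X₃}`.
Proof as printed: `g = g̃ * h` (`cmLift`, `cmDefect`), the scales `b ≤ V³` by Proposition 2.4
(`prop24_discrete` at scale `b` and frequency `bα`, using `1_𝒮(bm) = 1_{𝒮_{X₃/b}}(m)`), the scales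
`b > V³` trivially, and `∑ |h(b)| b^{-2/3} ≤ C_h` (proof of `MRT2015.keyEstimate_typ` verbatim).
[cite: MatomakiRadziwillTao2015, Theorem 2.3] -/
theorem keyEstimate_typ {mid : ℝ → ℝ} (hmid0 : ∀ M : ℝ, 0 ≤ M → 0 ≤ mid M)
    (hanti : ∀ a b : ℝ, 1 ≤ a → a ≤ b → mid b ≤ mid a) (hA2 : TheoremA2With mid)
    {κ Cm W₁ : ℝ} (hκ : 3 ≤ κ) (hCm : 0 ≤ Cm)
    (hdecay : ∀ W : ℝ, W₁ ≤ W → Real.sqrt (mid (κ * Real.log W - 48)) ≤ Cm * W ^ (-(5 : ℝ) / 4)) :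
    ∃ C V₀ Xs : ℝ, 0 < C ∧ ∀ (X X₃ V : ℝ) (L : ℕ) (α : ℝ) (g : ArithmeticFunction ℂ),
      g.IsMultiplicative → (∀ n, ‖g n‖ ≤ 1) →
      Xs ≤ X → X ≤ X₃ → X₃ ≤ 2 * X → V₀ ≤ V → V ^ 5 ≤ Real.log X ^ (1 / 125 : ℝ) →
      V ^ 1015 ≤ (L : ℝ) → (L : ℝ) * V ^ 75 ≤ X →
      (L : ℝ) ≤ Real.exp (Real.sqrt (Real.log X / 2)) →
      Real.log L ≤ V → 5 * κ * Real.log V ≤ Sieve.nonpretentiousness g X (V ^ 5) →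
      ∑ x ∈ range (⌊X₃⌋₊ + 1), ‖∑ n ∈ Ioc x (x + L),
          typFun g ((V ^ 5) ^ 200) (L / (V ^ 5) ^ 3) (Real.sqrt X₃) X₃ n * (𝐞 (α * n) : ℂ)‖ ≤
        C * L * X₃ / V := by
  obtain ⟨C₁, W₀, X₁, hC₁, h24⟩ := prop24_discrete hmid0 hanti hA2 hκ hCm hdecay
  have hCh := cmDefectBound_pos
  refine ⟨(4 * C₁ + 3) * cmDefectBound, max W₀ 3, max X₁ 1, by positivity, ?_⟩
  intro X X₃ V L α g hg hg1 hXs hXX₃ hX₃ hV₀ hVX hVL hLX hLexp hlogL hM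
  -- basics
  have hV3 : 3 ≤ V := (le_max_right _ _).trans hV₀
  have hV1 : 1 ≤ V := by linarith
  have hV0 : 0 < V := by linarith
  have hX₁ : X₁ ≤ X := (le_max_left _ _).trans hXs
  have hX1 : 1 ≤ X := (le_max_right _ _).trans hXs
  have hX₃1 : 1 ≤ X₃ := hX1.trans hXX₃
  have hX₃0 : 0 < X₃ := by linarith
  set W : ℝ := V ^ 5 with hW
  have hVW : V ≤ W := le_self_pow₀ hV1 (by norm_num)
  have hW₀ : W₀ ≤ W := ((le_max_left _ _).trans hV₀).trans hVW
  have hW1 : 1 ≤ W := hV1.trans hVW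
  have hW0 : 0 < W := by linarith
  have hW3 : 3 ≤ W := hV3.trans hVW
  have hWL : W ^ 203 ≤ (L : ℝ) := by rw [hW, ← pow_mul]; exact hVL
  have hLW15 : (L : ℝ) * W ^ 15 ≤ X := by rw [hW, ← pow_mul]; exact hLX
  have hLW : W ≤ (L : ℝ) := le_trans (le_self_pow₀ hW1 (by norm_num)) hWL
  have hL1 : (1 : ℝ) ≤ L := hW1.trans hLW
  have hL0 : (0 : ℝ) < L := by linarith
  have hL : 1 ≤ L := by exact_mod_cast hL1
  have hlogL0 : 0 ≤ Real.log L := Real.log_nonneg hL1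
  have hlogL5 : Real.log L ^ 5 ≤ W := pow_le_pow_left₀ hlogL0 hlogL 5
  have hLX' : (L : ℝ) ≤ X :=
    le_trans (le_mul_of_one_le_right hL0.le (one_le_pow₀ hW1)) hLW15
  have hLX₃ : (L : ℝ) ≤ X₃ := hLX'.trans hXX₃
  set N := ⌊X₃⌋₊ with hN
  have hNX : (N : ℝ) ≤ X₃ := Nat.floor_le hX₃0.le
  set P₁ : ℝ := W ^ 200 with hP₁
  set Q₁ : ℝ := L / W ^ 3 with hQ₁
  set X₀ : ℝ := Real.sqrt X₃ with hX₀
  -- the decomposition `g = g̃ * h`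
  set gt := cmLift g with hgt
  set h := cmDefect g with hh
  have hgt1 : ∀ n, ‖gt n‖ ≤ 1 := norm_cmLift_le_one g (fun p _ => hg1 p)
  have hgtmul : ∀ m n : ℕ, gt (m * n) = gt m * gt n := cmLift_mul g
  have hgt_one : gt 1 = 1 := (isMultiplicative_cmLift g).map_one
  have hMgt : κ * Real.log W ≤ Sieve.nonpretentiousness gt X W := by
    rw [nonpretentiousness_congr_primes (fun p hp => cmLift_prime g hp) X W]
    have e : Real.log W = 5 * Real.log V := by rw [hW, Real.log_pow]; push_cast; ring
    rw [e, show κ * (5 * Real.log V) = 5 * κ * Real.log V by ring]; exact hM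
  -- `P₁ > 1`, `log Q₁ ≥ 1`
  have hP1 : 1 < P₁ := by rw [hP₁]; exact one_lt_pow₀ (by linarith) (by norm_num)
  have hWP : W ≤ P₁ := by rw [hP₁]; exact le_self_pow₀ hW1 (by norm_num)
  have hlog3 : 1 ≤ Real.log 3 := by
    rw [← Real.log_exp 1]
    refine Real.log_le_log (Real.exp_pos 1) ?_
    have := Real.exp_one_lt_d9; linarith
  have hlogW : 1 ≤ Real.log W := hlog3.trans (Real.log_le_log (by norm_num) hW3)
  have hQW : W ≤ Q₁ := by
    rw [hQ₁, le_div_iff₀ (by positivity)]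
    calc W * W ^ 3 = W ^ 4 := by ring
      _ ≤ W ^ 203 := pow_le_pow_right₀ hW1 (by norm_num)
      _ ≤ L := hWL
  have hQ1 : 1 ≤ Real.log Q₁ := hlogW.trans (Real.log_le_log hW0 hQW)
  -- the split point `D = ⌊V³⌋`
  set D : ℕ := ⌊V ^ 3⌋₊ with hD
  have hDV : (D : ℝ) ≤ V ^ 3 := Nat.floor_le (by positivity)
  have hV3W : V ^ 3 < W := by rw [hW]; exact pow_lt_pow_right₀ (by linarith) (by norm_num)
  have hDP : (D : ℝ) < P₁ := by linarith
  obtain ⟨hD23, hD16, hD13⟩ := floor_cube_rpow_bounds hV1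
  -- the weight `w` and the window sums at each scale
  set w : ℕ → ℂ := fun n => if n ∈ typicalSet P₁ Q₁ X₀ X₃ then ((𝐞 (α * n) : ℂ)) else 0
    with hw
  have hw1 : ∀ n, ‖w n‖ ≤ 1 := fun n => norm_ite_fourierChar_le _ α n
  set U : ℕ → ℕ → ℂ := fun b x => ∑ m ∈ Ioc (x / b) ((x + L) / b), gt m * w (b * m) with hU
  set B := N + L with hB
  -- Step 1: Möbius inversion in every window
  have hstep1 : ∀ x ∈ range (N + 1), ∑ n ∈ Ioc x (x + L),
      typFun g P₁ Q₁ X₀ X₃ n * (𝐞 (α * n) : ℂ) = ∑ b ∈ Icc 1 B, h b * U b x := by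
    intro x hx
    have hxN : x ≤ N := Nat.lt_succ_iff.mp (Finset.mem_range.mp hx)
    have e1 : ∀ n, typFun g P₁ Q₁ X₀ X₃ n * (𝐞 (α * n) : ℂ) = (gt * h) n * w n := by
      intro n
      rw [hgt, hh, cmLift_mul_cmDefect]
      unfold typFun
      rw [hw]; dsimp only
      split_ifs <;> simp
    simp_rw [e1]
    exact window_convolution_eq gt h w (by omega)
  -- Step 2: small scales `b ≤ D`, by Proposition 2.4 at scale `b` and frequency `bα`
  have hsmall : ∀ b ∈ Icc 1 D, ∑ x ∈ range (N + 1), ‖U b x‖ ≤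
      C₁ * L * X₃ * (1 / V ^ 10 + (1 / V) * (1 / b) +
        (2 / (V * Real.sqrt V)) * (1 / Real.sqrt b)) := by
    intro b hb
    rw [Finset.mem_Icc] at hb
    have hb0 : 0 < b := hb.1
    have hb1 : (1 : ℝ) ≤ b := by exact_mod_cast hb.1
    have hb0' : (0 : ℝ) < b := by linarith
    have hbD : (b : ℝ) ≤ D := by exact_mod_cast hb.2
    have hbW : (b : ℝ) < W := by linarith
    have hsmallp : ∀ p : ℕ, p.Prime → p ∣ b → (p : ℝ) < P₁ := fun p _ hpb => by
      have hpb' : (p : ℝ) ≤ b := by exact_mod_cast Nat.le_of_dvd hb0 hpb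
      linarith
    -- identify `U b x` with the summand of Proposition 2.4 at scale `b`, frequency `bα`
    have hUeq : ∀ x, U b x = ∑ m ∈ Ioc (x / b) ((x + L) / b),
        typFun gt P₁ Q₁ X₀ (X₃ / b) m * (𝐞 ((α * b) * m) : ℂ) := by
      intro x
      rw [hU]; dsimp only
      refine Finset.sum_congr rfl fun m _ => ?_
      rw [hw]; dsimp only
      unfold typFun
      have e : α * ((b * m : ℕ) : ℝ) = α * b * m := by push_cast; ring
      by_cases hm : m ∈ typicalSet P₁ Q₁ X₀ (X₃ / b)
      · rw [if_pos hm, if_pos ((mul_mem_typicalSet_iff hb0 hP1 hQ1 hsmallp).mpr hm), e, mul_comm]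
      · rw [if_neg hm, if_neg (fun h' => hm ((mul_mem_typicalSet_iff hb0 hP1 hQ1 hsmallp).mp h')),
          mul_zero, zero_mul]
    simp_rw [hUeq]
    have h := h24 X X₃ W L b (α * b) gt hgtmul hgt_one hgt1 hX₁ hXX₃ hX₃ hW₀ hVX hb.1 hbW
      hWL hLW15 hLexp hlogL5 hMgt
    refine h.trans ?_
    -- from `W`-terms to `V`-terms
    have e1 : 1 / W ^ 2 = 1 / V ^ 10 := by rw [hW]; ring
    have e2 : 1 / ((b : ℝ) * W ^ (1 / 4 : ℝ)) ≤ (1 / V) * (1 / b) := by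
      rw [one_div_mul_one_div]
      refine one_div_le_one_div_of_le (by positivity) ?_
      rw [mul_comm V]
      exact mul_le_mul_of_nonneg_left (le_pow_five_rpow_quarter hV1) hb0'.le
    have e3 : (1 + Real.log L) / Real.sqrt (b * W) ≤
        (2 / (V * Real.sqrt V)) * (1 / Real.sqrt b) := by
      rw [Real.sqrt_mul hb0'.le, hW, sqrt_pow_five V, div_mul_div_comm, mul_one]
      rw [div_le_div_iff₀ (by positivity) (by positivity)]
      have hsV : 0 < Real.sqrt V := Real.sqrt_pos.mpr hV0
      have hsb : 0 < Real.sqrt b := Real.sqrt_pos.mpr hb0'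
      have hl : 1 + Real.log L ≤ 2 * V := by linarith
      calc (1 + Real.log L) * (V * Real.sqrt V * Real.sqrt b)
          ≤ (2 * V) * (V * Real.sqrt V * Real.sqrt b) :=
            mul_le_mul_of_nonneg_right hl (by positivity)
        _ = 2 * (Real.sqrt b * (V ^ 2 * Real.sqrt V)) := by ring
    have hsum : 1 / W ^ 2 + 1 / ((b : ℝ) * W ^ (1 / 4 : ℝ)) + (1 + Real.log L) / Real.sqrt (b * W)
        ≤ 1 / V ^ 10 + (1 / V) * (1 / b) + (2 / (V * Real.sqrt V)) * (1 / Real.sqrt b) := by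
      rw [e1]; linarith
    exact mul_le_mul_of_nonneg_left hsum (by positivity)
  -- Step 3: large scales `b > D`, trivially
  have hlarge : ∀ b ∈ Ioc D B, ∑ x ∈ range (N + 1), ‖U b x‖ ≤ 3 * L * X₃ * (1 / b) := by
    intro b hb
    rw [Finset.mem_Ioc] at hb
    have hb1 : 1 ≤ b := by omega
    have hb0' : (0 : ℝ) < b := by exact_mod_cast hb1
    have hc : ∀ m, ‖gt m * w (b * m)‖ ≤ 1 := fun m => by
      rw [norm_mul]; exact mul_le_one₀ (hgt1 m) (norm_nonneg _) (hw1 _)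
    have h1 := sum_norm_scale_trivial hc hb1 hL N
    refine h1.trans ?_
    rw [mul_one_div, div_le_div_iff_of_pos_right hb0']
    push_cast
    nlinarith
  -- Step 4: summation over the scales
  have hxbound : ∀ x ∈ range (N + 1), ‖∑ n ∈ Ioc x (x + L),
      typFun g P₁ Q₁ X₀ X₃ n * (𝐞 (α * n) : ℂ)‖ ≤ ∑ b ∈ Icc 1 B, ‖h b‖ * ‖U b x‖ := by
    intro x hx
    rw [hstep1 x hx]
    refine (norm_sum_le _ _).trans (Finset.sum_le_sum fun b _ => ?_)
    rw [norm_mul]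
  have hsub : Icc 1 B ⊆ Icc 1 D ∪ Ioc D B := by
    intro b hb
    rw [Finset.mem_union, Finset.mem_Icc, Finset.mem_Ioc]
    rw [Finset.mem_Icc] at hb
    omega
  have hdisj : Disjoint (Icc 1 D) (Ioc D B) := by
    rw [Finset.disjoint_left]
    intro b hb hb'
    rw [Finset.mem_Icc] at hb
    rw [Finset.mem_Ioc] at hb'
    omega
  -- the four weight sums
  have hS0 : ∑ b ∈ Icc 1 D, ‖h b‖ ≤ cmDefectBound * V ^ 2 :=
    (sum_norm_cmDefect_le hg hg1 D).trans (mul_le_mul_of_nonneg_left hD23 hCh.le)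
  have hS1 : ∑ b ∈ Icc 1 D, ‖h b‖ / b ≤ cmDefectBound := sum_norm_cmDefect_div_le hg hg1 D
  have hS2 : ∑ b ∈ Icc 1 D, ‖h b‖ / Real.sqrt b ≤ cmDefectBound * Real.sqrt V :=
    (sum_norm_cmDefect_div_sqrt_le hg hg1 D).trans (mul_le_mul_of_nonneg_left hD16 hCh.le)
  have hS3 : ∑ b ∈ Ioc D B, ‖h b‖ / b ≤ cmDefectBound * V⁻¹ :=
    (sum_norm_cmDefect_div_tail_le hg hg1 D B).trans (mul_le_mul_of_nonneg_left hD13 hCh.le)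
  calc ∑ x ∈ range (N + 1), ‖∑ n ∈ Ioc x (x + L), typFun g P₁ Q₁ X₀ X₃ n * (𝐞 (α * n) : ℂ)‖
      ≤ ∑ x ∈ range (N + 1), ∑ b ∈ Icc 1 B, ‖h b‖ * ‖U b x‖ := Finset.sum_le_sum hxbound
    _ = ∑ b ∈ Icc 1 B, ‖h b‖ * ∑ x ∈ range (N + 1), ‖U b x‖ := by
        rw [Finset.sum_comm]
        exact Finset.sum_congr rfl fun b _ => by rw [Finset.mul_sum]
    _ ≤ ∑ b ∈ Icc 1 D ∪ Ioc D B, ‖h b‖ * ∑ x ∈ range (N + 1), ‖U b x‖ :=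
        Finset.sum_le_sum_of_subset_of_nonneg hsub fun b _ _ =>
          mul_nonneg (norm_nonneg _) (Finset.sum_nonneg fun _ _ => norm_nonneg _)
    _ = ∑ b ∈ Icc 1 D, ‖h b‖ * ∑ x ∈ range (N + 1), ‖U b x‖ +
          ∑ b ∈ Ioc D B, ‖h b‖ * ∑ x ∈ range (N + 1), ‖U b x‖ := Finset.sum_union hdisj
    _ ≤ ∑ b ∈ Icc 1 D, ‖h b‖ * (C₁ * L * X₃ * (1 / V ^ 10 + (1 / V) * (1 / b) +
            (2 / (V * Real.sqrt V)) * (1 / Real.sqrt b))) +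
          ∑ b ∈ Ioc D B, ‖h b‖ * (3 * L * X₃ * (1 / b)) := by
        gcongr with b hb b hb
        · exact hsmall b hb
        · exact hlarge b hb
    _ = C₁ * L * X₃ * ((1 / V ^ 10) * ∑ b ∈ Icc 1 D, ‖h b‖ +
            (1 / V) * ∑ b ∈ Icc 1 D, ‖h b‖ / b +
            (2 / (V * Real.sqrt V)) * ∑ b ∈ Icc 1 D, ‖h b‖ / Real.sqrt b) +
          3 * L * X₃ * ∑ b ∈ Ioc D B, ‖h b‖ / b := by
        rw [Finset.mul_sum, Finset.mul_sum, Finset.mul_sum, Finset.mul_sum,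
          ← Finset.sum_add_distrib, ← Finset.sum_add_distrib, Finset.mul_sum]
        congr 1
        · exact Finset.sum_congr rfl fun b _ => by ring
        · exact Finset.sum_congr rfl fun b _ => by ring
    _ ≤ C₁ * L * X₃ * ((1 / V ^ 10) * (cmDefectBound * V ^ 2) + (1 / V) * cmDefectBound +
            (2 / (V * Real.sqrt V)) * (cmDefectBound * Real.sqrt V)) +
          3 * L * X₃ * (cmDefectBound * V⁻¹) := by
        gcongr
    _ = cmDefectBound * L * X₃ * (C₁ * (1 / V ^ 8 + 1 / V + 2 / V) + 3 / V) := by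
        have hsV : Real.sqrt V ≠ 0 := (Real.sqrt_pos.mpr hV0).ne'
        field_simp
    _ ≤ cmDefectBound * L * X₃ * (C₁ * (1 / V + 1 / V + 2 / V) + 3 / V) := by
        have h8 : 1 / V ^ 8 ≤ 1 / V := by
          refine one_div_le_one_div_of_le hV0 ?_
          exact le_self_pow₀ hV1 (by norm_num)
        have h0 : 0 ≤ cmDefectBound * L * X₃ := by positivity
        gcongr
    _ = (4 * C₁ + 3) * cmDefectBound * L * X₃ / V := by ring

end A2With

end MRT2015

end Literature.NumberTheory.LFunctions
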